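import Literature.Dynamics.Tilings.OllingerSupertiles
import HarnessLib

/-!
# The four window forms of a tiling occur in the supertile `S^6(x*)`

Every `2 × 2` window of a tiling by Ollinger's tiles is, by the decomposition of tilings into
images of tilings (`OllingerAperiodic.lean`, "`τ` codes `s`"), of one of four *forms* according
to the parities of its south-west cell: an image `s(a)` (form I), the straddle of two
horizontally adjacent images `s(a) | s(b)` (form II, a function `formII b` of `b` alone when
`a, b` match), of two vertically adjacent images (form III, `formIII c`), or the common corner of
four images (form IV, `formIV d`). This file records, for each good tile, a position at which the
corresponding form occurs as a window of the supertile `S^6(x*)` of order `6` of the corner tile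
(`tabI` … `tabIV`, generated by a search and VERIFIED by the kernel: `tabI_spec` …), and the
resulting lemmas `window_I` … `window_IV`: **every `2 × 2` window of every tiling is a window of
`S^6(x*)`** — the finite fact behind the linear net gluing of the Ollinger subshift (every
pattern of a tiling sits, at a computable place, inside one fixed supertile, which recurs on a
lattice in every tiling). (That the admissible `2 × 2` patterns are exactly the `416` windows of
`S^6(x*)` was found by computation; only the inclusion needed is proved here.)

## References

* N. Ollinger, *Two-by-Two Substitution Systems and the Undecidability of the Domino Problem*,
  CiE 2008, LNCS 5028, doi:10.1007/978-3-540-69407-6_51, §3 (the tile set; J.-V. attribute the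
  minimality of its tilings to Ballier's thesis).
-/

namespace Literature.Dynamics.Tilings.Ollinger

open Tile

/-- Natural-number coordinate of a bit. [folklore] -/
def bn (b : Bool) : ℕ := cond b 1 0

/-- [folklore] -/
@[simp] theorem bn_false : bn false = 0 := rfl

/-- [folklore] -/
@[simp] theorem bn_true : bn true = 1 := rfl

/-! ### The forms -/

/-- **Form II** (horizontal straddle `s(a) | s(b)`, east column of `s(a)` and west column of
`s(b)`), as a function of `b`: cell `(δ₁, δ₂)`. [cite: Ollinger2008, §3] -/
def formII (b : Tile) : B2 → Tile
  | (false, false) => ⟨(true, false), .H b.c.west.1 b.c.west.2 (b.l.2, !b.l.1)⟩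
  | (false, true) => ⟨(true, true), .X (!b.l.1, b.l.2)⟩
  | (true, false) => ⟨(false, false), b.c⟩
  | (true, true) => ⟨(false, true), .V b.c.north.1 b.c.north.2 b.l⟩

/-- **Form III** (vertical straddle, north row of `s(a)` under the south row of `s(c)`), as a
function of `c`. [cite: Ollinger2008, §3] -/
def formIII (c : Tile) : B2 → Tile
  | (false, false) => ⟨(false, true), .V c.c.south.1 c.c.south.2 (c.l.1, !c.l.2)⟩
  | (true, false) => ⟨(true, true), .X (c.l.1, !c.l.2)⟩
  | (false, true) => ⟨(false, false), c.c⟩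
  | (true, true) => ⟨(true, false), .H c.c.east.1 c.c.east.2 (c.l.2, c.l.1)⟩

/-- **Form IV** (the common corner of the images of a valid `2 × 2` pattern `[c d / a b]`: the
cells `11` of `s(a)`, `01` of `s(b)`, `10` of `s(c)`, `00` of `s(d)`), as a function of `d`.
[cite: Ollinger2008, §3] -/
def formIV (d : Tile) : B2 → Tile
  | (false, false) => ⟨(true, true), .X (!d.l.1, !d.l.2)⟩
  | (true, false) => ⟨(false, true), .V d.c.south.1 d.c.south.2 (d.l.1, !d.l.2)⟩
  | (false, true) => ⟨(true, false), .H d.c.west.1 d.c.west.2 (d.l.2, !d.l.1)⟩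
  | (true, true) => ⟨(false, false), d.c⟩

/-- Form II is the straddle of `s(a) | s(b)` whenever `a, b` match. [cite: Ollinger2008, §3] -/
theorem formII_link {a b : Tile} (hab : hmatch a b = true) (δ₂ : Bool) :
    subst (true, δ₂) a = formII b (false, δ₂) ∧ subst (false, δ₂) b = formII b (true, δ₂) := by
  obtain ⟨⟨a1, a2⟩, ca⟩ := a
  obtain ⟨⟨b1, b2⟩, cb⟩ := b
  simp only [hmatch, lE, Bool.and_eq_true, beq_iff_eq, Prod.mk.injEq] at hab
  obtain ⟨⟨h1, h2⟩, h3⟩ := hab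
  subst h1 h2
  cases δ₂ <;> simp [subst, formII, h3]

/-- Form III is the straddle of `s(a)` under `s(c)` whenever `a, c` match. [cite: Ollinger2008, §3] -/
theorem formIII_link {a c : Tile} (hac : vmatch a c = true) (δ₁ : Bool) :
    subst (δ₁, true) a = formIII c (δ₁, false) ∧ subst (δ₁, false) c = formIII c (δ₁, true) := by
  obtain ⟨⟨a1, a2⟩, ca⟩ := a
  obtain ⟨⟨c1, c2⟩, cc⟩ := c
  simp only [vmatch, lN, Bool.and_eq_true, beq_iff_eq, Prod.mk.injEq] at hac
  obtain ⟨⟨h1, h2⟩, h3⟩ := hac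
  subst h1 h2
  cases δ₁ <;> simp [subst, formIII, h3]

/-- Form IV is the corner of the images of `[c d / a b]` whenever these match.
[cite: Ollinger2008, §3] -/
theorem formIV_link {a b c d : Tile} (hab : hmatch a b = true) (hcd : hmatch c d = true)
    (hbd : vmatch b d = true) :
    subst (true, true) a = formIV d (false, false) ∧ subst (false, true) b = formIV d (true, false) ∧
      subst (true, false) c = formIV d (false, true) ∧ subst (false, false) d = formIV d (true, true) := by
  obtain ⟨⟨a1, a2⟩, ca⟩ := a
  obtain ⟨⟨b1, b2⟩, cb⟩ := b
  obtain ⟨⟨c1, c2⟩, cc⟩ := c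
  obtain ⟨⟨d1, d2⟩, cd⟩ := d
  simp only [hmatch, vmatch, lE, lN, Bool.and_eq_true, beq_iff_eq, Prod.mk.injEq] at hab hcd hbd
  obtain ⟨⟨h1, h2⟩, h3⟩ := hab
  obtain ⟨⟨h4, h5⟩, h6⟩ := hcd
  obtain ⟨⟨h7, h8⟩, h9⟩ := hbd
  subst h1 h2 h4 h5 h8
  have e1 : a1 = c1 := by cases a1 <;> cases c1 <;> simp_all
  subst e1
  simp [subst, formIV, h6, h9]

/-! ### The tables -/

/-- Positions in `S^6(x*)` of the window form I of each good tile (generated; verified below).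
[cite: Ollinger2008, §3] -/
def tabI : List (Tile × (ℕ × ℕ)) := [
  (⟨(false, false), Core.X (false, false)⟩, (4, 4)),
  (⟨(false, false), Core.X (true, false)⟩, (12, 4)),
  (⟨(false, false), Core.X (false, true)⟩, (4, 12)),
  (⟨(false, false), Core.X (true, true)⟩, (0, 0)),
  (⟨(false, false), Core.H (false, false) false (false, false)⟩, (52, 16)),
  (⟨(false, false), Core.H (false, false) false (false, true)⟩, (60, 16)),
  (⟨(false, false), Core.H (false, false) false (true, true)⟩, (28, 8)),
  (⟨(false, false), Core.H (false, false) true (false, false)⟩, (4, 16)),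
  (⟨(false, false), Core.H (false, false) true (true, false)⟩, (4, 8)),
  (⟨(false, false), Core.H (false, false) true (false, true)⟩, (12, 16)),
  (⟨(false, false), Core.H (true, false) false (false, false)⟩, (20, 16)),
  (⟨(false, false), Core.H (true, false) false (false, true)⟩, (28, 16)),
  (⟨(false, false), Core.H (true, false) false (true, true)⟩, (12, 8)),
  (⟨(false, false), Core.H (true, false) true (false, false)⟩, (36, 16)),
  (⟨(false, false), Core.H (true, false) true (true, false)⟩, (20, 8)),
  (⟨(false, false), Core.H (true, false) true (false, true)⟩, (44, 16)),
  (⟨(false, false), Core.H (false, true) false (false, false)⟩, (4, 0)),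
  (⟨(false, false), Core.H (false, true) false (false, true)⟩, (12, 0)),
  (⟨(false, false), Core.H (false, true) false (true, true)⟩, (28, 24)),
  (⟨(false, false), Core.H (false, true) true (false, false)⟩, (4, 48)),
  (⟨(false, false), Core.H (false, true) true (true, false)⟩, (4, 24)),
  (⟨(false, false), Core.H (false, true) true (false, true)⟩, (12, 48)),
  (⟨(false, false), Core.H (true, true) false (false, false)⟩, (20, 48)),
  (⟨(false, false), Core.H (true, true) false (false, true)⟩, (28, 48)),
  (⟨(false, false), Core.H (true, true) false (true, true)⟩, (12, 24)),
  (⟨(false, false), Core.H (true, true) true (false, false)⟩, (4, 32)),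
  (⟨(false, false), Core.H (true, true) true (true, false)⟩, (16, 32)),
  (⟨(false, false), Core.H (true, true) true (false, true)⟩, (12, 32)),
  (⟨(false, false), Core.V (false, false) false (false, false)⟩, (16, 52)),
  (⟨(false, false), Core.V (false, false) false (false, true)⟩, (16, 60)),
  (⟨(false, false), Core.V (false, false) false (true, true)⟩, (8, 28)),
  (⟨(false, false), Core.V (false, false) true (false, false)⟩, (16, 4)),
  (⟨(false, false), Core.V (false, false) true (true, false)⟩, (8, 4)),
  (⟨(false, false), Core.V (false, false) true (false, true)⟩, (16, 12)),
  (⟨(false, false), Core.V (true, false) false (false, false)⟩, (16, 20)),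
  (⟨(false, false), Core.V (true, false) false (false, true)⟩, (16, 28)),
  (⟨(false, false), Core.V (true, false) false (true, true)⟩, (8, 12)),
  (⟨(false, false), Core.V (true, false) true (false, false)⟩, (16, 36)),
  (⟨(false, false), Core.V (true, false) true (true, false)⟩, (8, 20)),
  (⟨(false, false), Core.V (true, false) true (false, true)⟩, (16, 44)),
  (⟨(false, false), Core.V (false, true) false (false, false)⟩, (0, 4)),
  (⟨(false, false), Core.V (false, true) false (false, true)⟩, (0, 12)),
  (⟨(false, false), Core.V (false, true) false (true, true)⟩, (0, 32)),
  (⟨(false, false), Core.V (false, true) true (false, false)⟩, (48, 4)),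
  (⟨(false, false), Core.V (false, true) true (true, false)⟩, (24, 4)),
  (⟨(false, false), Core.V (false, true) true (false, true)⟩, (48, 12)),
  (⟨(false, false), Core.V (true, true) false (false, false)⟩, (48, 20)),
  (⟨(false, false), Core.V (true, true) false (false, true)⟩, (48, 28)),
  (⟨(false, false), Core.V (true, true) false (true, true)⟩, (24, 12)),
  (⟨(false, false), Core.V (true, true) true (false, false)⟩, (32, 4)),
  (⟨(false, false), Core.V (true, true) true (true, false)⟩, (24, 20)),
  (⟨(false, false), Core.V (true, true) true (false, true)⟩, (32, 12)),
  (⟨(true, true), Core.X (false, false)⟩, (2, 2)),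
  (⟨(true, true), Core.X (true, false)⟩, (6, 2)),
  (⟨(true, true), Core.X (false, true)⟩, (2, 6)),
  (⟨(true, true), Core.X (true, true)⟩, (6, 6)),
  (⟨(true, false), Core.H (false, false) false (false, false)⟩, (26, 8)),
  (⟨(true, false), Core.H (false, false) false (false, true)⟩, (30, 8)),
  (⟨(true, false), Core.H (false, false) false (true, true)⟩, (14, 4)),
  (⟨(true, false), Core.H (false, false) true (false, false)⟩, (2, 8)),
  (⟨(true, false), Core.H (false, false) true (true, false)⟩, (2, 4)),
  (⟨(true, false), Core.H (false, false) true (false, true)⟩, (6, 8)),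
  (⟨(true, false), Core.H (true, false) false (false, false)⟩, (10, 8)),
  (⟨(true, false), Core.H (true, false) false (false, true)⟩, (14, 8)),
  (⟨(true, false), Core.H (true, false) false (true, true)⟩, (6, 4)),
  (⟨(true, false), Core.H (true, false) true (false, false)⟩, (18, 8)),
  (⟨(true, false), Core.H (true, false) true (true, false)⟩, (10, 4)),
  (⟨(true, false), Core.H (true, false) true (false, true)⟩, (22, 8)),
  (⟨(true, false), Core.H (false, true) false (false, false)⟩, (2, 0)),
  (⟨(true, false), Core.H (false, true) false (false, true)⟩, (6, 0)),
  (⟨(true, false), Core.H (false, true) false (true, true)⟩, (14, 12)),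
  (⟨(true, false), Core.H (false, true) true (false, false)⟩, (2, 24)),
  (⟨(true, false), Core.H (false, true) true (true, false)⟩, (2, 12)),
  (⟨(true, false), Core.H (false, true) true (false, true)⟩, (6, 24)),
  (⟨(true, false), Core.H (true, true) false (false, false)⟩, (10, 24)),
  (⟨(true, false), Core.H (true, true) false (false, true)⟩, (14, 24)),
  (⟨(true, false), Core.H (true, true) false (true, true)⟩, (6, 12)),
  (⟨(true, false), Core.H (true, true) true (false, false)⟩, (2, 32)),
  (⟨(true, false), Core.H (true, true) true (true, false)⟩, (10, 12)),
  (⟨(true, false), Core.H (true, true) true (false, true)⟩, (6, 32)),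
  (⟨(false, true), Core.V (false, false) false (false, false)⟩, (8, 26)),
  (⟨(false, true), Core.V (false, false) false (false, true)⟩, (8, 30)),
  (⟨(false, true), Core.V (false, false) false (true, true)⟩, (4, 14)),
  (⟨(false, true), Core.V (false, false) true (false, false)⟩, (8, 2)),
  (⟨(false, true), Core.V (false, false) true (true, false)⟩, (4, 2)),
  (⟨(false, true), Core.V (false, false) true (false, true)⟩, (8, 6)),
  (⟨(false, true), Core.V (true, false) false (false, false)⟩, (8, 10)),
  (⟨(false, true), Core.V (true, false) false (false, true)⟩, (8, 14)),
  (⟨(false, true), Core.V (true, false) false (true, true)⟩, (4, 6)),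
  (⟨(false, true), Core.V (true, false) true (false, false)⟩, (8, 18)),
  (⟨(false, true), Core.V (true, false) true (true, false)⟩, (4, 10)),
  (⟨(false, true), Core.V (true, false) true (false, true)⟩, (8, 22)),
  (⟨(false, true), Core.V (false, true) false (false, false)⟩, (0, 2)),
  (⟨(false, true), Core.V (false, true) false (false, true)⟩, (0, 6)),
  (⟨(false, true), Core.V (false, true) false (true, true)⟩, (12, 14)),
  (⟨(false, true), Core.V (false, true) true (false, false)⟩, (24, 2)),
  (⟨(false, true), Core.V (false, true) true (true, false)⟩, (12, 2)),
  (⟨(false, true), Core.V (false, true) true (false, true)⟩, (24, 6)),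
  (⟨(false, true), Core.V (true, true) false (false, false)⟩, (24, 10)),
  (⟨(false, true), Core.V (true, true) false (false, true)⟩, (24, 14)),
  (⟨(false, true), Core.V (true, true) false (true, true)⟩, (12, 6)),
  (⟨(false, true), Core.V (true, true) true (false, false)⟩, (24, 18)),
  (⟨(false, true), Core.V (true, true) true (true, false)⟩, (12, 10)),
  (⟨(false, true), Core.V (true, true) true (false, true)⟩, (24, 22))]

/-- Positions in `S^6(x*)` of the window form II of each good tile (generated; verified below).
[cite: Ollinger2008, §3] -/
def tabII : List (Tile × (ℕ × ℕ)) := [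
  (⟨(false, false), Core.X (false, false)⟩, (3, 4)),
  (⟨(false, false), Core.X (true, false)⟩, (11, 4)),
  (⟨(false, false), Core.X (false, true)⟩, (3, 12)),
  (⟨(false, false), Core.X (true, true)⟩, (11, 12)),
  (⟨(false, false), Core.H (false, false) false (false, false)⟩, (51, 16)),
  (⟨(false, false), Core.H (false, false) false (false, true)⟩, (59, 16)),
  (⟨(false, false), Core.H (false, false) false (true, true)⟩, (27, 8)),
  (⟨(false, false), Core.H (false, false) true (false, false)⟩, (3, 16)),
  (⟨(false, false), Core.H (false, false) true (true, false)⟩, (3, 8)),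
  (⟨(false, false), Core.H (false, false) true (false, true)⟩, (11, 16)),
  (⟨(false, false), Core.H (true, false) false (false, false)⟩, (19, 16)),
  (⟨(false, false), Core.H (true, false) false (false, true)⟩, (27, 16)),
  (⟨(false, false), Core.H (true, false) false (true, true)⟩, (11, 8)),
  (⟨(false, false), Core.H (true, false) true (false, false)⟩, (35, 16)),
  (⟨(false, false), Core.H (true, false) true (true, false)⟩, (19, 8)),
  (⟨(false, false), Core.H (true, false) true (false, true)⟩, (43, 16)),
  (⟨(false, false), Core.H (false, true) false (false, false)⟩, (3, 0)),
  (⟨(false, false), Core.H (false, true) false (false, true)⟩, (11, 0)),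
  (⟨(false, false), Core.H (false, true) false (true, true)⟩, (27, 24)),
  (⟨(false, false), Core.H (false, true) true (false, false)⟩, (3, 48)),
  (⟨(false, false), Core.H (false, true) true (true, false)⟩, (3, 24)),
  (⟨(false, false), Core.H (false, true) true (false, true)⟩, (11, 48)),
  (⟨(false, false), Core.H (true, true) false (false, false)⟩, (19, 48)),
  (⟨(false, false), Core.H (true, true) false (false, true)⟩, (27, 48)),
  (⟨(false, false), Core.H (true, true) false (true, true)⟩, (11, 24)),
  (⟨(false, false), Core.H (true, true) true (false, false)⟩, (3, 32)),
  (⟨(false, false), Core.H (true, true) true (true, false)⟩, (15, 32)),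
  (⟨(false, false), Core.H (true, true) true (false, true)⟩, (11, 32)),
  (⟨(false, false), Core.V (false, false) false (false, false)⟩, (15, 52)),
  (⟨(false, false), Core.V (false, false) false (false, true)⟩, (15, 60)),
  (⟨(false, false), Core.V (false, false) false (true, true)⟩, (7, 28)),
  (⟨(false, false), Core.V (false, false) true (false, false)⟩, (15, 4)),
  (⟨(false, false), Core.V (false, false) true (true, false)⟩, (7, 4)),
  (⟨(false, false), Core.V (false, false) true (false, true)⟩, (15, 12)),
  (⟨(false, false), Core.V (true, false) false (false, false)⟩, (15, 20)),
  (⟨(false, false), Core.V (true, false) false (false, true)⟩, (15, 28)),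
  (⟨(false, false), Core.V (true, false) false (true, true)⟩, (7, 12)),
  (⟨(false, false), Core.V (true, false) true (false, false)⟩, (15, 36)),
  (⟨(false, false), Core.V (true, false) true (true, false)⟩, (7, 20)),
  (⟨(false, false), Core.V (true, false) true (false, true)⟩, (15, 44)),
  (⟨(false, false), Core.V (false, true) false (false, false)⟩, (31, 36)),
  (⟨(false, false), Core.V (false, true) false (false, true)⟩, (31, 44)),
  (⟨(false, false), Core.V (false, true) false (true, true)⟩, (23, 28)),
  (⟨(false, false), Core.V (false, true) true (false, false)⟩, (47, 4)),
  (⟨(false, false), Core.V (false, true) true (true, false)⟩, (23, 4)),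
  (⟨(false, false), Core.V (false, true) true (false, true)⟩, (47, 12)),
  (⟨(false, false), Core.V (true, true) false (false, false)⟩, (47, 20)),
  (⟨(false, false), Core.V (true, true) false (false, true)⟩, (47, 28)),
  (⟨(false, false), Core.V (true, true) false (true, true)⟩, (23, 12)),
  (⟨(false, false), Core.V (true, true) true (false, false)⟩, (31, 4)),
  (⟨(false, false), Core.V (true, true) true (true, false)⟩, (23, 20)),
  (⟨(false, false), Core.V (true, true) true (false, true)⟩, (31, 12)),
  (⟨(true, true), Core.X (false, false)⟩, (1, 2)),
  (⟨(true, true), Core.X (true, false)⟩, (5, 2)),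
  (⟨(true, true), Core.X (false, true)⟩, (1, 6)),
  (⟨(true, true), Core.X (true, true)⟩, (5, 6)),
  (⟨(true, false), Core.H (false, false) false (false, false)⟩, (25, 8)),
  (⟨(true, false), Core.H (false, false) false (false, true)⟩, (29, 8)),
  (⟨(true, false), Core.H (false, false) false (true, true)⟩, (13, 4)),
  (⟨(true, false), Core.H (false, false) true (false, false)⟩, (1, 8)),
  (⟨(true, false), Core.H (false, false) true (true, false)⟩, (1, 4)),
  (⟨(true, false), Core.H (false, false) true (false, true)⟩, (5, 8)),
  (⟨(true, false), Core.H (true, false) false (false, false)⟩, (9, 8)),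
  (⟨(true, false), Core.H (true, false) false (false, true)⟩, (13, 8)),
  (⟨(true, false), Core.H (true, false) false (true, true)⟩, (5, 4)),
  (⟨(true, false), Core.H (true, false) true (false, false)⟩, (17, 8)),
  (⟨(true, false), Core.H (true, false) true (true, false)⟩, (9, 4)),
  (⟨(true, false), Core.H (true, false) true (false, true)⟩, (21, 8)),
  (⟨(true, false), Core.H (false, true) false (false, false)⟩, (1, 0)),
  (⟨(true, false), Core.H (false, true) false (false, true)⟩, (5, 0)),
  (⟨(true, false), Core.H (false, true) false (true, true)⟩, (13, 12)),
  (⟨(true, false), Core.H (false, true) true (false, false)⟩, (1, 24)),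
  (⟨(true, false), Core.H (false, true) true (true, false)⟩, (1, 12)),
  (⟨(true, false), Core.H (false, true) true (false, true)⟩, (5, 24)),
  (⟨(true, false), Core.H (true, true) false (false, false)⟩, (9, 24)),
  (⟨(true, false), Core.H (true, true) false (false, true)⟩, (13, 24)),
  (⟨(true, false), Core.H (true, true) false (true, true)⟩, (5, 12)),
  (⟨(true, false), Core.H (true, true) true (false, false)⟩, (1, 32)),
  (⟨(true, false), Core.H (true, true) true (true, false)⟩, (9, 12)),
  (⟨(true, false), Core.H (true, true) true (false, true)⟩, (5, 32)),
  (⟨(false, true), Core.V (false, false) false (false, false)⟩, (7, 26)),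
  (⟨(false, true), Core.V (false, false) false (false, true)⟩, (7, 30)),
  (⟨(false, true), Core.V (false, false) false (true, true)⟩, (3, 14)),
  (⟨(false, true), Core.V (false, false) true (false, false)⟩, (7, 2)),
  (⟨(false, true), Core.V (false, false) true (true, false)⟩, (3, 2)),
  (⟨(false, true), Core.V (false, false) true (false, true)⟩, (7, 6)),
  (⟨(false, true), Core.V (true, false) false (false, false)⟩, (7, 10)),
  (⟨(false, true), Core.V (true, false) false (false, true)⟩, (7, 14)),
  (⟨(false, true), Core.V (true, false) false (true, true)⟩, (3, 6)),
  (⟨(false, true), Core.V (true, false) true (false, false)⟩, (7, 18)),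
  (⟨(false, true), Core.V (true, false) true (true, false)⟩, (3, 10)),
  (⟨(false, true), Core.V (true, false) true (false, true)⟩, (7, 22)),
  (⟨(false, true), Core.V (false, true) false (false, false)⟩, (23, 26)),
  (⟨(false, true), Core.V (false, true) false (false, true)⟩, (23, 30)),
  (⟨(false, true), Core.V (false, true) false (true, true)⟩, (11, 14)),
  (⟨(false, true), Core.V (false, true) true (false, false)⟩, (23, 2)),
  (⟨(false, true), Core.V (false, true) true (true, false)⟩, (11, 2)),
  (⟨(false, true), Core.V (false, true) true (false, true)⟩, (23, 6)),
  (⟨(false, true), Core.V (true, true) false (false, false)⟩, (23, 10)),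
  (⟨(false, true), Core.V (true, true) false (false, true)⟩, (23, 14)),
  (⟨(false, true), Core.V (true, true) false (true, true)⟩, (11, 6)),
  (⟨(false, true), Core.V (true, true) true (false, false)⟩, (23, 18)),
  (⟨(false, true), Core.V (true, true) true (true, false)⟩, (11, 10)),
  (⟨(false, true), Core.V (true, true) true (false, true)⟩, (23, 22))]

/-- Positions in `S^6(x*)` of the window form III of each good tile (generated; verified below).
[cite: Ollinger2008, §3] -/
def tabIII : List (Tile × (ℕ × ℕ)) := [
  (⟨(false, false), Core.X (false, false)⟩, (4, 3)),
  (⟨(false, false), Core.X (true, false)⟩, (12, 3)),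
  (⟨(false, false), Core.X (false, true)⟩, (4, 11)),
  (⟨(false, false), Core.X (true, true)⟩, (12, 11)),
  (⟨(false, false), Core.H (false, false) false (false, false)⟩, (52, 15)),
  (⟨(false, false), Core.H (false, false) false (false, true)⟩, (60, 15)),
  (⟨(false, false), Core.H (false, false) false (true, true)⟩, (28, 7)),
  (⟨(false, false), Core.H (false, false) true (false, false)⟩, (4, 15)),
  (⟨(false, false), Core.H (false, false) true (true, false)⟩, (4, 7)),
  (⟨(false, false), Core.H (false, false) true (false, true)⟩, (12, 15)),
  (⟨(false, false), Core.H (true, false) false (false, false)⟩, (20, 15)),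
  (⟨(false, false), Core.H (true, false) false (false, true)⟩, (28, 15)),
  (⟨(false, false), Core.H (true, false) false (true, true)⟩, (12, 7)),
  (⟨(false, false), Core.H (true, false) true (false, false)⟩, (36, 15)),
  (⟨(false, false), Core.H (true, false) true (true, false)⟩, (20, 7)),
  (⟨(false, false), Core.H (true, false) true (false, true)⟩, (44, 15)),
  (⟨(false, false), Core.H (false, true) false (false, false)⟩, (36, 31)),
  (⟨(false, false), Core.H (false, true) false (false, true)⟩, (44, 31)),
  (⟨(false, false), Core.H (false, true) false (true, true)⟩, (28, 23)),
  (⟨(false, false), Core.H (false, true) true (false, false)⟩, (4, 47)),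
  (⟨(false, false), Core.H (false, true) true (true, false)⟩, (4, 23)),
  (⟨(false, false), Core.H (false, true) true (false, true)⟩, (12, 47)),
  (⟨(false, false), Core.H (true, true) false (false, false)⟩, (20, 47)),
  (⟨(false, false), Core.H (true, true) false (false, true)⟩, (28, 47)),
  (⟨(false, false), Core.H (true, true) false (true, true)⟩, (12, 23)),
  (⟨(false, false), Core.H (true, true) true (false, false)⟩, (4, 31)),
  (⟨(false, false), Core.H (true, true) true (true, false)⟩, (16, 31)),
  (⟨(false, false), Core.H (true, true) true (false, true)⟩, (12, 31)),
  (⟨(false, false), Core.V (false, false) false (false, false)⟩, (16, 51)),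
  (⟨(false, false), Core.V (false, false) false (false, true)⟩, (16, 59)),
  (⟨(false, false), Core.V (false, false) false (true, true)⟩, (8, 27)),
  (⟨(false, false), Core.V (false, false) true (false, false)⟩, (16, 3)),
  (⟨(false, false), Core.V (false, false) true (true, false)⟩, (8, 3)),
  (⟨(false, false), Core.V (false, false) true (false, true)⟩, (16, 11)),
  (⟨(false, false), Core.V (true, false) false (false, false)⟩, (16, 19)),
  (⟨(false, false), Core.V (true, false) false (false, true)⟩, (16, 27)),
  (⟨(false, false), Core.V (true, false) false (true, true)⟩, (8, 11)),
  (⟨(false, false), Core.V (true, false) true (false, false)⟩, (16, 35)),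
  (⟨(false, false), Core.V (true, false) true (true, false)⟩, (8, 19)),
  (⟨(false, false), Core.V (true, false) true (false, true)⟩, (16, 43)),
  (⟨(false, false), Core.V (false, true) false (false, false)⟩, (0, 3)),
  (⟨(false, false), Core.V (false, true) false (false, true)⟩, (0, 11)),
  (⟨(false, false), Core.V (false, true) false (true, true)⟩, (0, 31)),
  (⟨(false, false), Core.V (false, true) true (false, false)⟩, (48, 3)),
  (⟨(false, false), Core.V (false, true) true (true, false)⟩, (24, 3)),
  (⟨(false, false), Core.V (false, true) true (false, true)⟩, (48, 11)),
  (⟨(false, false), Core.V (true, true) false (false, false)⟩, (48, 19)),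
  (⟨(false, false), Core.V (true, true) false (false, true)⟩, (48, 27)),
  (⟨(false, false), Core.V (true, true) false (true, true)⟩, (24, 11)),
  (⟨(false, false), Core.V (true, true) true (false, false)⟩, (32, 3)),
  (⟨(false, false), Core.V (true, true) true (true, false)⟩, (24, 19)),
  (⟨(false, false), Core.V (true, true) true (false, true)⟩, (32, 11)),
  (⟨(true, true), Core.X (false, false)⟩, (2, 1)),
  (⟨(true, true), Core.X (true, false)⟩, (6, 1)),
  (⟨(true, true), Core.X (false, true)⟩, (2, 5)),
  (⟨(true, true), Core.X (true, true)⟩, (6, 5)),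
  (⟨(true, false), Core.H (false, false) false (false, false)⟩, (26, 7)),
  (⟨(true, false), Core.H (false, false) false (false, true)⟩, (30, 7)),
  (⟨(true, false), Core.H (false, false) false (true, true)⟩, (14, 3)),
  (⟨(true, false), Core.H (false, false) true (false, false)⟩, (2, 7)),
  (⟨(true, false), Core.H (false, false) true (true, false)⟩, (2, 3)),
  (⟨(true, false), Core.H (false, false) true (false, true)⟩, (6, 7)),
  (⟨(true, false), Core.H (true, false) false (false, false)⟩, (10, 7)),
  (⟨(true, false), Core.H (true, false) false (false, true)⟩, (14, 7)),
  (⟨(true, false), Core.H (true, false) false (true, true)⟩, (6, 3)),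
  (⟨(true, false), Core.H (true, false) true (false, false)⟩, (18, 7)),
  (⟨(true, false), Core.H (true, false) true (true, false)⟩, (10, 3)),
  (⟨(true, false), Core.H (true, false) true (false, true)⟩, (22, 7)),
  (⟨(true, false), Core.H (false, true) false (false, false)⟩, (26, 23)),
  (⟨(true, false), Core.H (false, true) false (false, true)⟩, (30, 23)),
  (⟨(true, false), Core.H (false, true) false (true, true)⟩, (14, 11)),
  (⟨(true, false), Core.H (false, true) true (false, false)⟩, (2, 23)),
  (⟨(true, false), Core.H (false, true) true (true, false)⟩, (2, 11)),
  (⟨(true, false), Core.H (false, true) true (false, true)⟩, (6, 23)),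
  (⟨(true, false), Core.H (true, true) false (false, false)⟩, (10, 23)),
  (⟨(true, false), Core.H (true, true) false (false, true)⟩, (14, 23)),
  (⟨(true, false), Core.H (true, true) false (true, true)⟩, (6, 11)),
  (⟨(true, false), Core.H (true, true) true (false, false)⟩, (2, 31)),
  (⟨(true, false), Core.H (true, true) true (true, false)⟩, (10, 11)),
  (⟨(true, false), Core.H (true, true) true (false, true)⟩, (6, 31)),
  (⟨(false, true), Core.V (false, false) false (false, false)⟩, (8, 25)),
  (⟨(false, true), Core.V (false, false) false (false, true)⟩, (8, 29)),
  (⟨(false, true), Core.V (false, false) false (true, true)⟩, (4, 13)),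
  (⟨(false, true), Core.V (false, false) true (false, false)⟩, (8, 1)),
  (⟨(false, true), Core.V (false, false) true (true, false)⟩, (4, 1)),
  (⟨(false, true), Core.V (false, false) true (false, true)⟩, (8, 5)),
  (⟨(false, true), Core.V (true, false) false (false, false)⟩, (8, 9)),
  (⟨(false, true), Core.V (true, false) false (false, true)⟩, (8, 13)),
  (⟨(false, true), Core.V (true, false) false (true, true)⟩, (4, 5)),
  (⟨(false, true), Core.V (true, false) true (false, false)⟩, (8, 17)),
  (⟨(false, true), Core.V (true, false) true (true, false)⟩, (4, 9)),
  (⟨(false, true), Core.V (true, false) true (false, true)⟩, (8, 21)),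
  (⟨(false, true), Core.V (false, true) false (false, false)⟩, (0, 1)),
  (⟨(false, true), Core.V (false, true) false (false, true)⟩, (0, 5)),
  (⟨(false, true), Core.V (false, true) false (true, true)⟩, (12, 13)),
  (⟨(false, true), Core.V (false, true) true (false, false)⟩, (24, 1)),
  (⟨(false, true), Core.V (false, true) true (true, false)⟩, (12, 1)),
  (⟨(false, true), Core.V (false, true) true (false, true)⟩, (24, 5)),
  (⟨(false, true), Core.V (true, true) false (false, false)⟩, (24, 9)),
  (⟨(false, true), Core.V (true, true) false (false, true)⟩, (24, 13)),
  (⟨(false, true), Core.V (true, true) false (true, true)⟩, (12, 5)),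
  (⟨(false, true), Core.V (true, true) true (false, false)⟩, (24, 17)),
  (⟨(false, true), Core.V (true, true) true (true, false)⟩, (12, 9)),
  (⟨(false, true), Core.V (true, true) true (false, true)⟩, (24, 21))]

/-- Positions in `S^6(x*)` of the window form IV of each good tile (generated; verified below).
[cite: Ollinger2008, §3] -/
def tabIV : List (Tile × (ℕ × ℕ)) := [
  (⟨(false, false), Core.X (false, false)⟩, (3, 3)),
  (⟨(false, false), Core.X (true, false)⟩, (11, 3)),
  (⟨(false, false), Core.X (false, true)⟩, (3, 11)),
  (⟨(false, false), Core.X (true, true)⟩, (11, 11)),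
  (⟨(false, false), Core.H (false, false) false (false, false)⟩, (51, 15)),
  (⟨(false, false), Core.H (false, false) false (false, true)⟩, (59, 15)),
  (⟨(false, false), Core.H (false, false) false (true, true)⟩, (27, 7)),
  (⟨(false, false), Core.H (false, false) true (false, false)⟩, (3, 15)),
  (⟨(false, false), Core.H (false, false) true (true, false)⟩, (3, 7)),
  (⟨(false, false), Core.H (false, false) true (false, true)⟩, (11, 15)),
  (⟨(false, false), Core.H (true, false) false (false, false)⟩, (19, 15)),
  (⟨(false, false), Core.H (true, false) false (false, true)⟩, (27, 15)),
  (⟨(false, false), Core.H (true, false) false (true, true)⟩, (11, 7)),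
  (⟨(false, false), Core.H (true, false) true (false, false)⟩, (35, 15)),
  (⟨(false, false), Core.H (true, false) true (true, false)⟩, (19, 7)),
  (⟨(false, false), Core.H (true, false) true (false, true)⟩, (43, 15)),
  (⟨(false, false), Core.H (false, true) false (false, false)⟩, (35, 31)),
  (⟨(false, false), Core.H (false, true) false (false, true)⟩, (43, 31)),
  (⟨(false, false), Core.H (false, true) false (true, true)⟩, (27, 23)),
  (⟨(false, false), Core.H (false, true) true (false, false)⟩, (3, 47)),
  (⟨(false, false), Core.H (false, true) true (true, false)⟩, (3, 23)),
  (⟨(false, false), Core.H (false, true) true (false, true)⟩, (11, 47)),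
  (⟨(false, false), Core.H (true, true) false (false, false)⟩, (19, 47)),
  (⟨(false, false), Core.H (true, true) false (false, true)⟩, (27, 47)),
  (⟨(false, false), Core.H (true, true) false (true, true)⟩, (11, 23)),
  (⟨(false, false), Core.H (true, true) true (false, false)⟩, (3, 31)),
  (⟨(false, false), Core.H (true, true) true (true, false)⟩, (15, 31)),
  (⟨(false, false), Core.H (true, true) true (false, true)⟩, (11, 31)),
  (⟨(false, false), Core.V (false, false) false (false, false)⟩, (15, 51)),
  (⟨(false, false), Core.V (false, false) false (false, true)⟩, (15, 59)),
  (⟨(false, false), Core.V (false, false) false (true, true)⟩, (7, 27)),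
  (⟨(false, false), Core.V (false, false) true (false, false)⟩, (15, 3)),
  (⟨(false, false), Core.V (false, false) true (true, false)⟩, (7, 3)),
  (⟨(false, false), Core.V (false, false) true (false, true)⟩, (15, 11)),
  (⟨(false, false), Core.V (true, false) false (false, false)⟩, (15, 19)),
  (⟨(false, false), Core.V (true, false) false (false, true)⟩, (15, 27)),
  (⟨(false, false), Core.V (true, false) false (true, true)⟩, (7, 11)),
  (⟨(false, false), Core.V (true, false) true (false, false)⟩, (15, 35)),
  (⟨(false, false), Core.V (true, false) true (true, false)⟩, (7, 19)),
  (⟨(false, false), Core.V (true, false) true (false, true)⟩, (15, 43)),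
  (⟨(false, false), Core.V (false, true) false (false, false)⟩, (31, 35)),
  (⟨(false, false), Core.V (false, true) false (false, true)⟩, (31, 43)),
  (⟨(false, false), Core.V (false, true) false (true, true)⟩, (23, 27)),
  (⟨(false, false), Core.V (false, true) true (false, false)⟩, (47, 3)),
  (⟨(false, false), Core.V (false, true) true (true, false)⟩, (23, 3)),
  (⟨(false, false), Core.V (false, true) true (false, true)⟩, (47, 11)),
  (⟨(false, false), Core.V (true, true) false (false, false)⟩, (47, 19)),
  (⟨(false, false), Core.V (true, true) false (false, true)⟩, (47, 27)),
  (⟨(false, false), Core.V (true, true) false (true, true)⟩, (23, 11)),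
  (⟨(false, false), Core.V (true, true) true (false, false)⟩, (31, 3)),
  (⟨(false, false), Core.V (true, true) true (true, false)⟩, (23, 19)),
  (⟨(false, false), Core.V (true, true) true (false, true)⟩, (31, 11)),
  (⟨(true, true), Core.X (false, false)⟩, (1, 1)),
  (⟨(true, true), Core.X (true, false)⟩, (5, 1)),
  (⟨(true, true), Core.X (false, true)⟩, (1, 5)),
  (⟨(true, true), Core.X (true, true)⟩, (5, 5)),
  (⟨(true, false), Core.H (false, false) false (false, false)⟩, (25, 7)),
  (⟨(true, false), Core.H (false, false) false (false, true)⟩, (29, 7)),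
  (⟨(true, false), Core.H (false, false) false (true, true)⟩, (13, 3)),
  (⟨(true, false), Core.H (false, false) true (false, false)⟩, (1, 7)),
  (⟨(true, false), Core.H (false, false) true (true, false)⟩, (1, 3)),
  (⟨(true, false), Core.H (false, false) true (false, true)⟩, (5, 7)),
  (⟨(true, false), Core.H (true, false) false (false, false)⟩, (9, 7)),
  (⟨(true, false), Core.H (true, false) false (false, true)⟩, (13, 7)),
  (⟨(true, false), Core.H (true, false) false (true, true)⟩, (5, 3)),
  (⟨(true, false), Core.H (true, false) true (false, false)⟩, (17, 7)),
  (⟨(true, false), Core.H (true, false) true (true, false)⟩, (9, 3)),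
  (⟨(true, false), Core.H (true, false) true (false, true)⟩, (21, 7)),
  (⟨(true, false), Core.H (false, true) false (false, false)⟩, (25, 23)),
  (⟨(true, false), Core.H (false, true) false (false, true)⟩, (29, 23)),
  (⟨(true, false), Core.H (false, true) false (true, true)⟩, (13, 11)),
  (⟨(true, false), Core.H (false, true) true (false, false)⟩, (1, 23)),
  (⟨(true, false), Core.H (false, true) true (true, false)⟩, (1, 11)),
  (⟨(true, false), Core.H (false, true) true (false, true)⟩, (5, 23)),
  (⟨(true, false), Core.H (true, true) false (false, false)⟩, (9, 23)),
  (⟨(true, false), Core.H (true, true) false (false, true)⟩, (13, 23)),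
  (⟨(true, false), Core.H (true, true) false (true, true)⟩, (5, 11)),
  (⟨(true, false), Core.H (true, true) true (false, false)⟩, (1, 31)),
  (⟨(true, false), Core.H (true, true) true (true, false)⟩, (9, 11)),
  (⟨(true, false), Core.H (true, true) true (false, true)⟩, (5, 31)),
  (⟨(false, true), Core.V (false, false) false (false, false)⟩, (7, 25)),
  (⟨(false, true), Core.V (false, false) false (false, true)⟩, (7, 29)),
  (⟨(false, true), Core.V (false, false) false (true, true)⟩, (3, 13)),
  (⟨(false, true), Core.V (false, false) true (false, false)⟩, (7, 1)),
  (⟨(false, true), Core.V (false, false) true (true, false)⟩, (3, 1)),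
  (⟨(false, true), Core.V (false, false) true (false, true)⟩, (7, 5)),
  (⟨(false, true), Core.V (true, false) false (false, false)⟩, (7, 9)),
  (⟨(false, true), Core.V (true, false) false (false, true)⟩, (7, 13)),
  (⟨(false, true), Core.V (true, false) false (true, true)⟩, (3, 5)),
  (⟨(false, true), Core.V (true, false) true (false, false)⟩, (7, 17)),
  (⟨(false, true), Core.V (true, false) true (true, false)⟩, (3, 9)),
  (⟨(false, true), Core.V (true, false) true (false, true)⟩, (7, 21)),
  (⟨(false, true), Core.V (false, true) false (false, false)⟩, (23, 25)),
  (⟨(false, true), Core.V (false, true) false (false, true)⟩, (23, 29)),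
  (⟨(false, true), Core.V (false, true) false (true, true)⟩, (11, 13)),
  (⟨(false, true), Core.V (false, true) true (false, false)⟩, (23, 1)),
  (⟨(false, true), Core.V (false, true) true (true, false)⟩, (11, 1)),
  (⟨(false, true), Core.V (false, true) true (false, true)⟩, (23, 5)),
  (⟨(false, true), Core.V (true, true) false (false, false)⟩, (23, 9)),
  (⟨(false, true), Core.V (true, true) false (false, true)⟩, (23, 13)),
  (⟨(false, true), Core.V (true, true) false (true, true)⟩, (11, 5)),
  (⟨(false, true), Core.V (true, true) true (false, false)⟩, (23, 17)),
  (⟨(false, true), Core.V (true, true) true (true, false)⟩, (11, 9)),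
  (⟨(false, true), Core.V (true, true) true (false, true)⟩, (23, 21))]

/-- Look a tile up in a position table (`(0, 0)` if absent, never used). [folklore] -/
def lookupPos (tab : List (Tile × (ℕ × ℕ))) (t : Tile) : ℕ × ℕ :=
  match tab.find? (fun e => e.1 == t) with
  | some e => e.2
  | none => (0, 0)

/-- The window of `S^6(x*)` at `π` is `F` (cellwise), and lies inside the supertile. [folklore] -/
def winCheck (π : ℕ × ℕ) (F : B2 → Tile) : Bool :=
  (π.1 + 2 ≤ 64 && π.2 + 2 ≤ 64) &&
    allB2.all fun δ => cellS 6 xstar (π.1 + bn δ.1) (π.2 + bn δ.2) == F δ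

/-- [folklore] -/
theorem of_winCheck {π : ℕ × ℕ} {F : B2 → Tile} (h : winCheck π F = true) :
    π.1 + 2 ≤ 64 ∧ π.2 + 2 ≤ 64 ∧ ∀ δ : B2, cellS 6 xstar (π.1 + bn δ.1) (π.2 + bn δ.2) = F δ := by
  simp only [winCheck, Bool.and_eq_true, decide_eq_true_eq] at h
  obtain ⟨⟨h1, h2⟩, h3⟩ := h
  refine ⟨h1, h2, fun δ => ?_⟩
  exact beq_iff_eq.mp (List.all_eq_true.mp h3 δ (mem_allB2 δ))

/-- **Kernel verification of `tabI`**: for every good tile `a`, the image `s(a)` is the window of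
`S^6(x*)` at `tabI a`. [cite: Ollinger2008, §3] -/
theorem tabI_spec : (allGood.all fun a => winCheck (lookupPos tabI a) (fun δ => subst δ a)) = true := by
  decide +kernel

/-- **Kernel verification of `tabII`.** [cite: Ollinger2008, §3] -/
theorem tabII_spec : (allGood.all fun b => winCheck (lookupPos tabII b) (formII b)) = true := by
  decide +kernel

/-- **Kernel verification of `tabIII`.** [cite: Ollinger2008, §3] -/
theorem tabIII_spec : (allGood.all fun c => winCheck (lookupPos tabIII c) (formIII c)) = true := by
  decide +kernel

/-- **Kernel verification of `tabIV`.** [cite: Ollinger2008, §3] -/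
theorem tabIV_spec : (allGood.all fun d => winCheck (lookupPos tabIV d) (formIV d)) = true := by
  decide +kernel

/-! ### Every `2 × 2` window form is a window of `S^6(x*)` -/

/-- **Form I**: the image of a good tile is a window of `S^6(x*)`. [cite: Ollinger2008, §3] -/
theorem window_I {a : Tile} (ha : a.good = true) : ∃ π : ℕ × ℕ, π.1 + 2 ≤ 64 ∧ π.2 + 2 ≤ 64 ∧
    ∀ δ : B2, cellS 6 xstar (π.1 + bn δ.1) (π.2 + bn δ.2) = subst δ a :=
  ⟨_, of_winCheck (of_allGood_all tabI_spec ha)⟩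

/-- **Form II**: the straddle of the images of two horizontally matching good tiles is a window of
`S^6(x*)`. [cite: Ollinger2008, §3] -/
theorem window_II {a b : Tile} (hb : b.good = true) (hab : hmatch a b = true) :
    ∃ π : ℕ × ℕ, π.1 + 2 ≤ 64 ∧ π.2 + 2 ≤ 64 ∧ ∀ δ₂ : Bool,
      cellS 6 xstar π.1 (π.2 + bn δ₂) = subst (true, δ₂) a ∧
        cellS 6 xstar (π.1 + 1) (π.2 + bn δ₂) = subst (false, δ₂) b := by
  obtain ⟨h1, h2, h3⟩ := of_winCheck (of_allGood_all tabII_spec hb)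
  refine ⟨_, h1, h2, fun δ₂ => ?_⟩
  obtain ⟨e1, e2⟩ := formII_link hab δ₂
  rw [e1, e2, ← h3 (false, δ₂), ← h3 (true, δ₂)]
  simp

/-- **Form III**: the straddle of the images of two vertically matching good tiles is a window
of `S^6(x*)`. [cite: Ollinger2008, §3] -/
theorem window_III {a c : Tile} (hc : c.good = true) (hac : vmatch a c = true) :
    ∃ π : ℕ × ℕ, π.1 + 2 ≤ 64 ∧ π.2 + 2 ≤ 64 ∧ ∀ δ₁ : Bool,
      cellS 6 xstar (π.1 + bn δ₁) π.2 = subst (δ₁, true) a ∧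
        cellS 6 xstar (π.1 + bn δ₁) (π.2 + 1) = subst (δ₁, false) c := by
  obtain ⟨h1, h2, h3⟩ := of_winCheck (of_allGood_all tabIII_spec hc)
  refine ⟨_, h1, h2, fun δ₁ => ?_⟩
  obtain ⟨e1, e2⟩ := formIII_link hac δ₁
  rw [e1, e2, ← h3 (δ₁, false), ← h3 (δ₁, true)]
  simp

/-- **Form IV**: the common corner of the images of a valid `2 × 2` pattern of good tiles is a
window of `S^6(x*)`. [cite: Ollinger2008, §3] -/
theorem window_IV {a b c d : Tile} (hd : d.good = true) (hab : hmatch a b = true)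
    (hcd : hmatch c d = true) (hbd : vmatch b d = true) :
    ∃ π : ℕ × ℕ, π.1 + 2 ≤ 64 ∧ π.2 + 2 ≤ 64 ∧
      cellS 6 xstar π.1 π.2 = subst (true, true) a ∧ cellS 6 xstar (π.1 + 1) π.2 = subst (false, true) b ∧
        cellS 6 xstar π.1 (π.2 + 1) = subst (true, false) c ∧
          cellS 6 xstar (π.1 + 1) (π.2 + 1) = subst (false, false) d := by
  obtain ⟨h1, h2, h3⟩ := of_winCheck (of_allGood_all tabIV_spec hd)
  obtain ⟨e1, e2, e3, e4⟩ := formIV_link hab hcd hbd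
  refine ⟨_, h1, h2, ?_, ?_, ?_, ?_⟩
  · rw [e1, ← h3 (false, false)]; simp
  · rw [e2, ← h3 (true, false)]; simp
  · rw [e3, ← h3 (false, true)]; simp
  · rw [e4, ← h3 (true, true)]; simp

end Literature.Dynamics.Tilings.Ollinger
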